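import Summits.AtomisticToContinuum.Crystallization.Theses.PalmUnimodularRigidity
import Literature.Probability.Process.PointStationaryLaw
import Literature.MathematicalPhysics.StatisticalMechanics.RootEnergy

/-!
# Line `coarse-holonomy-liouville` — checked skeleton for crux `MinimiserShells`
(item stmt-AtomisticToContinuum-9225, route `PalmUnimodularRigidity`, rank 2)

Crux (by name, `minimiserShells_iff` below is `Iff.rfl`): every minimising (`E_P[h] ≤ e*`)
point-stationary `δ`-hard-core probability law on rooted configurations of `ℝ³` has, almost surely,
an `(a/100)`-close-packed root shell (`GoodShell 100`).

## The line (idea card `coarse-holonomy-liouville`, crux-ideate round 1, triage r1-2/r1-3: pass with doubt)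

TOLERANCE LADDER `a/20 → a/100`.  The crux's threshold `a/100` sits in the ELASTIC regime, where
the cheapest violators are homogeneously strained close packings costing `≈ 4.4e-4 = 0.06 % |e*|`
(Disproof §5, kit j008791): no energetic certificate can be asked to resolve that.  The line splits
the work at the coarse tolerance `a/20`:

* COARSE RUNG (`stub_coarsePricing`, the frustration core, hardest): linear pricing of the COARSE
  predicate — `e* + c·P(root shell not (a/20)-good) ≤ E_P[h]` over all point-stationary hard-core
  probability laws, for some `c > 0` (ceiling now `c ≤ 8.5e-3 = 1.2 % |e*|`, the cost of a 5 % tetragonal strain of fcc,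
  kit j010899 A — 25× the fine ceiling 3.4e-4; bcc 4.3 %, every tabulated non-close-packed monatomic
  LJ structure ≥ 1 %).
  This is where an LP / defect-exchange / ring-tax certificate with Mecke rows plugs in; the line
  itself only lowers the resolution such a certificate needs from 6e-4 to ~1e-2 relative.
* PALM TRANSFER (`stub_everyPoint`): root a.s. ⇒ every point a.s. (mass transport with
  `g(μ, y) = 1_N(θ_y μ)`; the Lean cost is joint measurability of re-rooting in the Giry σ-algebra).
* ZERO HOLONOMY = GLOBAL CHART (`stub_chart`, pure geometry): a set all of whose points have
  `(a/20)`-good shells is bond-isomorphic to an ideal Barlow stacking (the robust layer theorem —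
  crux `ShellsToBarlowChart` 9227 with the hypothesis weakened from `a/100` to `a/20`; shell TYPE
  and contact graph are unambiguous up to `a/10`).  A global chart is exactly the statement that the
  lattice holonomy of every loop vanishes; there are no cores because EVERY site is coarse-good.
* TUBE LIOUVILLE (`stub_tubeLiouville`, measure-level Friesecke–James–Müller / Theil rigidity):
  a minimising law almost surely carried by charted, everywhere-`(a/20)`-good configurations has
  `(a/100)`-good root shells a.s.  Mechanism: `E_P[h] = e*` exactly (minimising + `e_uni ≥ e*`,
  the hypothesis `UnimodularEnergyLowerBound` = item 9229, derived here from the coarse pricing);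
  a random-grid mass transport (as in 9229's sketch) makes `E_P[h]` the expected CELL AVERAGE of
  `h` and `E_P[strain defect at the root]` the expected cell average of the strain defect; for a
  finite block `B` of a charted configuration the energy-well + geometric-rigidity estimate
  `E_int(B, Φ) ≥ |B|·e(s) + κ·Σ_B dist²(∇Φ, SO(3)·F_s*) − C·|∂B|` (zero stress of the relaxed
  stacking `L_s*` kills first-order terms; all pair distances of a close packing exceed `2^(-1/6)`,
  so missing surface bonds only raise `E_int`; `e(s) ≥ e*` by periodisation 0715) gives
  `κ·E_P[dist²] ≤ E_P[h] − e* + C/L = C/L` for every grid size `L`: the strain defect vanishes a.s.,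
  discrete Liouville makes the configuration an exact rotated RELAXED stacking, whose shells are
  `≈ 1e-4·a` from ideal, inside `a/100`.  `κ > 0` = coercivity of every relaxed Barlow stacking in
  the `a/20` tube (kits j010899 / j011122 of this seat: Hessian min non-zero eigenvalue > 0 for fcc,
  hcp, dhcp, ABCBCB, 9R supercells; `(E(x₀+u) − E₀)/(½uᵀHu) ≥ 0.975` for all sampled periodic fields
  of sup-amplitude `a/20`, `≥ 0.94` at `a/14`; layer-dependent relaxation of the polytypes `≤ 2.4e-5·a`).  No stacking selection is needed (`e(s) ≥ e*` for every
  Hägg word by definition of `e*` and periodic approximation), which is what separates this stub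
  from crux 9226 `LayeredLawsSelectHcp`.

`MinimiserShells_of : MinimiserShells` applies the four registered stubs BY NAME to the sorry-free
`minimiserShells_of_rungs` (the four stub statements ⇒ the crux's unfolded conclusion: outer-measure
bookkeeping as in Disproof §5 `minimiserShells_of_linearPricing`, the derivation of 9229 from the
coarse pricing as in `unimodularEnergyLowerBound_of_linearPricing`, and the re-rooting identities
`map_sub_count_restrict` / `count_restrict_singleton_ne_zero_iff` of the Literature file).

## Disproof.lean obstructions honoured (tree `Cruxes/MinimiserShells/Disproof.lean`, gen 2)
* `minimiserShells_false_without_energy` (§2a): `E_P[h] ≤ e*` is used in `MinimiserShells_of`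
  (coarse pricing ⇒ `P(coarse-bad) = 0`) and is a hypothesis of `stub_tubeLiouville`.
* `minimiserShells_false_without_stationarity` / `not_pointwiseMinimiserShells` (§2b–c): no stub is
  a pointwise energy ⇒ shell certificate; `stub_coarsePricing` is an EXPECTATION inequality over
  point-stationary laws (the transfer term lives inside its proof), `stub_everyPoint` is the Mecke
  identity itself, `stub_tubeLiouville` uses Mecke for the null-Lagrangian terms.
* `minimiserShells_imp_unimodularEnergyLowerBound` (§3): 9229 is explicit — it is DERIVED from
  `stub_coarsePricing` (`unimodularEnergyLowerBound_of_coarsePricing`) and fed to `stub_tubeLiouville`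
  by name.
* `not_minimiserShellsSlack_*` (§4): no stub is stable under `E ↦ E + s`; exact minimality enters
  twice (coarse: `c·P(bad) ≤ E − e* = 0`; fine: `κ·E[strain²] ≤ E − e* = 0`).
* `linearPricing_ceiling` (§5, `c ≤ 4.4e-4` for the FINE predicate): the line never prices the fine
  predicate; the coarse predicate's ceiling is 8.5e-3, 25× higher (kit j010899 part A).
* §6a–c (normalisation, unit mass, genuine re-rooting): all stubs keep `IsProbabilityMeasure`,
  `μ = count|S` and the full Mecke identity; §7 (rootedness free) not used.
* Landed Negative lemmas (`Theorems/MinimiserShells/Negative/{LoadBearing,HiddenDependency,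
  UniformRooting,PricingCeiling,MultRooted,ReflectionOnly,Rootedness}`): no stub is an instance of a
  refuted statement (none is pointwise, slack, unnormalised, mult-rooted or reflection-only).
-/

noncomputable section

open MeasureTheory
open scoped ENNReal

namespace Summit.AtomisticToContinuum.Crystallization.Cruxes.MinimiserShells.CoarseHolonomyLiouville

open Literature.Probability.Process (IsPointStationaryLaw IsRootedHardCore
  count_restrict_singleton_ne_zero_iff map_sub_count_restrict)
open Literature.MathematicalPhysics.StatisticalMechanics (lennardJones PeriodicConfiguration
  IsHaggSeq barlowStacking)
open Literature.Geometry.DiscreteGeometry (ShellCloseTo EtaMatched fccKissingPattern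
  hcpKissingPattern)
open Summit.AtomisticToContinuum.Crystallization.Theses.PalmUnimodularRigidity
  (MinimiserShells UnimodularEnergyLowerBound)

/-- Euclidean 3-space. -/
abbrev E3 := EuclideanSpace ℝ (Fin 3)

/-- `e* = ⨅_Q e_LJ(Q)` over periodic configurations (the route's inlined term). -/
def eStar : ℝ := ⨅ Q : PeriodicConfiguration 3, Q.energyPerParticle lennardJones

/-- Mean root energy `E_P[h]`, `h μ = ½ ∫ V_LJ(‖y‖) dμ` (the route's inlined term). -/
def meanRootEnergy (P : Measure (Measure E3)) : ℝ := ∫ μ, (∫ y, lennardJones ‖y‖ ∂μ) / 2 ∂P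

/-- **Good root shell at tolerance `a/k`**: for some scale `a ∈ [9/10, 1]` the configuration points
`y ≠ 0` with `‖y‖ ≤ 5a/4` form a finite set `(a/k)`-matched, after a linear isometry, to the
`a`-scaled FCC or HCP kissing pattern.  `k = 100` is the crux's conclusion verbatim
(`minimiserShells_iff`), `k = 20` the COARSE rung of this line. -/
def GoodShell (k : ℝ) (μ : Measure E3) : Prop :=
  ∃ a : ℝ, 9 / 10 ≤ a ∧ a ≤ 1 ∧ ∃ T : Finset E3,
    (↑T : Set E3) = {y : E3 | μ {y} ≠ 0 ∧ y ≠ 0 ∧ ‖y‖ ≤ 5 / 4 * a} ∧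
    (ShellCloseTo (a / k) T (Finset.image (fun v : E3 => a • v) fccKissingPattern) ∨
      ShellCloseTo (a / k) T (Finset.image (fun v : E3 => a • v) hcpKissingPattern))

/-- **Barlow chart** of a point set `S` (the conclusion of crux `ShellsToBarlowChart` verbatim):
`S` is bond-isomorphic to the ideal Barlow stacking of some Hägg word `s` — a bijection
`Φ : barlowStacking 1 √(2/3) s → S` with ideal contacts `↔` pairs at distance in `(0, 28/25]`.
Zero lattice holonomy on every loop is exactly the existence of such a global chart. -/
def IsBarlowCharted (S : Set E3) : Prop :=
  ∃ s : ℤ → ℤ, IsHaggSeq s ∧ ∃ Φ : E3 → E3,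
    Set.BijOn Φ (barlowStacking 1 (Real.sqrt (2 / 3)) s) S ∧
    ∀ p ∈ barlowStacking 1 (Real.sqrt (2 / 3)) s, ∀ q ∈ barlowStacking 1 (Real.sqrt (2 / 3)) s,
      (dist p q = 1 ↔ (0 < dist (Φ p) (Φ q) ∧ dist (Φ p) (Φ q) ≤ 28 / 25))

/-! ## Read-back (definitional) -/

/-- The crux, symbol for symbol, in this file's vocabulary. [folklore] -/
theorem minimiserShells_iff :
    MinimiserShells ↔ ∀ δ : ℝ, 0 < δ → ∀ P : Measure (Measure E3), IsProbabilityMeasure P →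
      (∀ᵐ μ ∂P, IsRootedHardCore δ μ) → IsPointStationaryLaw P → meanRootEnergy P ≤ eStar →
      ∀ᵐ μ ∂P, GoodShell 100 μ :=
  Iff.rfl

/-- Support item 9229 `UnimodularEnergyLowerBound` (`e_uni ≥ e*`), read back. [folklore] -/
theorem unimodularEnergyLowerBound_iff :
    UnimodularEnergyLowerBound ↔ ∀ δ : ℝ, 0 < δ → ∀ P : Measure (Measure E3),
      IsProbabilityMeasure P → (∀ᵐ μ ∂P, IsRootedHardCore δ μ) → IsPointStationaryLaw P →
      eStar ≤ meanRootEnergy P :=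
  Iff.rfl

/-- Matching is monotone in the tolerance, hence so is `ShellCloseTo`. [folklore] -/
theorem shellCloseTo_mono {η η' : ℝ} (hη : η ≤ η') {T P : Finset E3} (h : ShellCloseTo η T P) :
    ShellCloseTo η' T P := by
  obtain ⟨A, hA⟩ := h
  exact ⟨A, hA.mono hη⟩

/-- The ladder is a ladder: a finer tolerance implies a coarser one (`GoodShell k → GoodShell k'`
for `0 < k' ≤ k`); in particular the crux's conclusion `GoodShell 100` implies the coarse rung's
predicate `GoodShell 20`, so `stub_coarsePricing` prices a SMALLER bad event than the fine linear
pricing of Disproof §5. [folklore] -/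
theorem goodShell_mono {k k' : ℝ} (hk' : 0 < k') (hkk' : k' ≤ k) {μ : Measure E3}
    (h : GoodShell k μ) : GoodShell k' μ := by
  obtain ⟨a, ha1, ha2, T, hT, hclose⟩ := h
  have ha0 : 0 ≤ a := by linarith
  have hle : a / k ≤ a / k' := div_le_div_of_nonneg_left ha0 hk' hkk'
  refine ⟨a, ha1, ha2, T, hT, ?_⟩
  rcases hclose with hc | hc
  · exact Or.inl (shellCloseTo_mono hle hc)
  · exact Or.inr (shellCloseTo_mono hle hc)

/-! ## The four registered stubs -/

/-- **STUB 1 — coarse linear pricing (the frustration core; HARDEST).**  For every hard core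
`δ > 0` there is `c > 0` such that every point-stationary `δ`-hard-core probability law satisfies
`e* + c·P(root shell not (a/20)-good) ≤ E_P[h]`.  Ceiling: `c ≤ e(Q) − e*` for every periodic `Q`
all of whose shells are coarse-bad — 8.5e-3 from 5 % tetragonal strain of fcc, 1.5e-2 for hcp (kit j010899 A),
3.1e-2 from bcc; it also contains particle-wise positive surface tension at percent level
(`E(N) ≥ N e* + c·#surface`, via uniformly rooted clusters, Disproof §4) and item 9229.
Intended mechanism: a zero-loss transport / exchange certificate with Mecke rows at ~1e-2 relative
resolution (cards cluster-defect-pricing, defect-exchange-two-resolutions, link-euler-six-ring-tax,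
octahedral-annulus-mandate supply candidate rows).  Why it might fail: a point-stationary hard-core
law with coarse-bad (icosahedral / polytetrahedral / Frank–Kasper) root shells of positive
probability and `E_P[h] = e*` — i.e. a non-close-packed LJ ground state; or `c` not uniform over laws. -/
theorem stub_coarsePricing :
    ∀ δ : ℝ, 0 < δ → ∃ c : ℝ, 0 < c ∧
      ∀ P : Measure (Measure E3), IsProbabilityMeasure P →
        (∀ᵐ μ ∂P, IsRootedHardCore δ μ) → IsPointStationaryLaw P →
        eStar + c * (P {μ | ¬ GoodShell 20 μ}).toReal ≤ meanRootEnergy P := by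
  sorry

/-- **STUB 2 — Palm "root a.s. ⇒ every point a.s." transfer.**  Under a point-stationary law
a.s. carried by rooted hard-core (counting) configurations, an almost-sure property of the rooted
configuration holds almost surely at EVERY point after re-rooting: Mecke with
`g(μ, y) = 1_N(θ_y μ)`, `N ⊇ Aᶜ` a measurable null set, and `θ_{−y} θ_y μ = μ`.  Lean cost: joint
measurability of `(μ, y) ↦ μ.map (· − y)` for the Giry σ-algebra and the passage from
`μ{y : θ_y μ ∈ N} = 0` to "no atom" for counting measures.  (Content of the route's support item
`CruxesToPalmRigidity`; stated for an arbitrary set `A`, outer-measure form.) -/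
theorem stub_everyPoint :
    ∀ δ : ℝ, 0 < δ → ∀ P : Measure (Measure E3),
      (∀ᵐ μ ∂P, IsRootedHardCore δ μ) → IsPointStationaryLaw P →
      ∀ A : Set (Measure E3), (∀ᵐ μ ∂P, μ ∈ A) →
        ∀ᵐ μ ∂P, ∀ y : E3, μ {y} ≠ 0 → Measure.map (fun z => z - y) μ ∈ A := by
  sorry

/-- **STUB 3 — zero holonomy: the robust layer theorem at tolerance `a/20` (pure geometry).**
A non-empty set every point of which has an `(a/20)`-good shell (in the re-rooted counting-measure
phrasing: `GoodShell 20 (count|(S − x))`) is bond-isomorphic to an ideal Barlow stacking.  This is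
crux `ShellsToBarlowChart` (9227) with the hypothesis weakened from `a/100` to `a/20`: shell type
(FCC vs HCP differ by `0.58a`) and contact graph (contacts `a(1 ± 2/20)` vs `√2·a ∓ 2a/20`) are
still unambiguous, the bond window `(0, 28/25]` still separates shell pairs (`≤ 1.05`) from all
others (`> 1.125`); the exact case is `HalesDSP_layerPackings_holds` in tree.  Why it might fail:
an everywhere-coarse-good Delone set with exotic global layer topology (non-parallel close-packed
planes meeting without a badly coordinated junction atom) — the same risk as 9227, at 5× the slack. -/
theorem stub_chart :
    ∀ S : Set E3, S.Nonempty →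
      (∀ x ∈ S, GoodShell 20 ((Measure.count : Measure E3).restrict ((fun y => y - x) '' S))) →
      IsBarlowCharted S := by
  sorry

/-- **STUB 4 — tube Liouville (measure-level elastic rigidity, no stacking selection).**  A
minimising point-stationary hard-core probability law (with `e_uni ≥ e*`, item 9229, as a named
hypothesis) that is a.s. carried by configurations all of whose points are `(a/20)`-good AND which
are Barlow-charted has `(a/100)`-good root shells almost surely.  Mechanism: `E_P[h] = e*`; random-
grid mass transport turns `E_P[h]` and `E_P[strain defect]` into expected cell averages; the finite-
block energy-well + rigidity estimate `E_int(B, Φ) ≥ |B| e(s) + κ Σ_B dist²(∇Φ, SO(3) F_s*) − C|∂B|`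
for charted blocks in the `a/20` tube (zero stress of `L_s*`, surface bonds attractive, `e(s) ≥ e*`
by periodisation) gives `κ E_P[dist²] ≤ C/L → 0`, hence strain `∈ SO(3)` a.s., discrete Liouville ⇒
exact rotated relaxed stacking, shells `~1e-4·a` from ideal; no ergodicity and no stacking selection
(`e(s) ≥ e*` suffices — the difference from crux 9226).  Why it might fail: the `a/20` tube is wider
than the coercivity basin of relaxed LJ hcp/fcc with the `r⁻⁶` tail (per-site `a/20` allows 10 %
bond strain; kits j010899 B / j011122 found the harmonic coercivity intact to 2.5 % at a/20 for periodic
fields about relaxed fcc, hcp, dhcp, ABCBCB and 9R supercells — fixed cell, ≈ 9a, sampled not certified), or some Barlow polytype is elastically soft, or the measure-level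
integration by parts leaks for non-ergodic / aperiodic Hägg words. -/
theorem stub_tubeLiouville :
    ∀ δ : ℝ, 0 < δ → ∀ P : Measure (Measure E3), IsProbabilityMeasure P →
      (∀ᵐ μ ∂P, IsRootedHardCore δ μ) → IsPointStationaryLaw P → meanRootEnergy P ≤ eStar →
      UnimodularEnergyLowerBound →
      (∀ᵐ μ ∂P, ∀ y : E3, μ {y} ≠ 0 → GoodShell 20 (Measure.map (fun z => z - y) μ)) →
      (∀ᵐ μ ∂P, ∃ S : Set E3, μ = (Measure.count : Measure E3).restrict S ∧ IsBarlowCharted S) →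
      ∀ᵐ μ ∂P, GoodShell 100 μ := by
  sorry

/-! ## Composition: the four stub statements prove the crux BY NAME -/

/-- The coarse pricing already contains support item 9229 (`e_uni ≥ e*`), honouring Disproof §3
(`minimiserShells_imp_unimodularEnergyLowerBound`): drop the non-negative pricing term. [folklore] -/
theorem unimodularEnergyLowerBound_of_coarsePricing
    (hC : (∀ δ : ℝ, 0 < δ → ∃ c : ℝ, 0 < c ∧
      ∀ P : Measure (Measure E3), IsProbabilityMeasure P →
        (∀ᵐ μ ∂P, IsRootedHardCore δ μ) → IsPointStationaryLaw P →
        eStar + c * (P {μ | ¬ GoodShell 20 μ}).toReal ≤ meanRootEnergy P)) :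
    UnimodularEnergyLowerBound := by
  rw [unimodularEnergyLowerBound_iff]
  intro δ hδ P hP hcore hstat
  obtain ⟨c, hc, hLP⟩ := hC δ hδ
  have hineq := hLP P hP hcore hstat
  have h0 : 0 ≤ c * (P {μ | ¬ GoodShell 20 μ}).toReal := mul_nonneg hc.le ENNReal.toReal_nonneg
  linarith

/-- Exact minimality + coarse pricing ⇒ the root shell is almost surely COARSE-good
(outer-measure bookkeeping only; no measurability of the shell event is needed). [folklore] -/
theorem ae_coarseGood_of_coarsePricing
    (hC : (∀ δ : ℝ, 0 < δ → ∃ c : ℝ, 0 < c ∧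
      ∀ P : Measure (Measure E3), IsProbabilityMeasure P →
        (∀ᵐ μ ∂P, IsRootedHardCore δ μ) → IsPointStationaryLaw P →
        eStar + c * (P {μ | ¬ GoodShell 20 μ}).toReal ≤ meanRootEnergy P))
    {δ : ℝ} (hδ : 0 < δ) (P : Measure (Measure E3)) (hP : IsProbabilityMeasure P)
    (hcore : ∀ᵐ μ ∂P, IsRootedHardCore δ μ) (hstat : IsPointStationaryLaw P)
    (hE : meanRootEnergy P ≤ eStar) :
    ∀ᵐ μ ∂P, GoodShell 20 μ := by
  obtain ⟨c, hc, hLP⟩ := hC δ hδ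
  have hineq := hLP P hP hcore hstat
  have h1 : c * (P {μ | ¬ GoodShell 20 μ}).toReal ≤ 0 := by linarith
  have h2 : 0 ≤ (P {μ | ¬ GoodShell 20 μ}).toReal := ENNReal.toReal_nonneg
  have hzero : (P {μ | ¬ GoodShell 20 μ}).toReal = 0 := by nlinarith
  rw [ae_iff]
  rcases (ENNReal.toReal_eq_zero_iff _).1 hzero with h0 | htop
  · exact h0
  · exact absurd htop (measure_ne_top P _)

/-- **The logic of the line, sorry-free**: the four stub STATEMENTS (taken as hypotheses, so that
this lemma's axiom closure is clean) imply the crux's unfolded conclusion — coarse pricing ⇒ a.s.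
coarse-good root and 9229; Palm transfer ⇒ every atom coarse-good; chart; tube Liouville.
[folklore] -/
theorem minimiserShells_of_rungs :
    (∀ δ : ℝ, 0 < δ → ∃ c : ℝ, 0 < c ∧
      ∀ P : Measure (Measure E3), IsProbabilityMeasure P →
        (∀ᵐ μ ∂P, IsRootedHardCore δ μ) → IsPointStationaryLaw P →
        eStar + c * (P {μ | ¬ GoodShell 20 μ}).toReal ≤ meanRootEnergy P) →
    (∀ δ : ℝ, 0 < δ → ∀ P : Measure (Measure E3),
      (∀ᵐ μ ∂P, IsRootedHardCore δ μ) → IsPointStationaryLaw P →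
      ∀ A : Set (Measure E3), (∀ᵐ μ ∂P, μ ∈ A) →
        ∀ᵐ μ ∂P, ∀ y : E3, μ {y} ≠ 0 → Measure.map (fun z => z - y) μ ∈ A) →
    (∀ S : Set E3, S.Nonempty →
      (∀ x ∈ S, GoodShell 20 ((Measure.count : Measure E3).restrict ((fun y => y - x) '' S))) →
      IsBarlowCharted S) →
    (∀ δ : ℝ, 0 < δ → ∀ P : Measure (Measure E3), IsProbabilityMeasure P →
      (∀ᵐ μ ∂P, IsRootedHardCore δ μ) → IsPointStationaryLaw P → meanRootEnergy P ≤ eStar →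
      UnimodularEnergyLowerBound →
      (∀ᵐ μ ∂P, ∀ y : E3, μ {y} ≠ 0 → GoodShell 20 (Measure.map (fun z => z - y) μ)) →
      (∀ᵐ μ ∂P, ∃ S : Set E3, μ = (Measure.count : Measure E3).restrict S ∧ IsBarlowCharted S) →
      ∀ᵐ μ ∂P, GoodShell 100 μ) →
    ∀ δ : ℝ, 0 < δ → ∀ P : Measure (Measure E3), IsProbabilityMeasure P →
      (∀ᵐ μ ∂P, IsRootedHardCore δ μ) → IsPointStationaryLaw P → meanRootEnergy P ≤ eStar →
      ∀ᵐ μ ∂P, GoodShell 100 μ := by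
  intro hC hE hCh hR δ hδ P hP hcore hstat hEn
  -- rung 1: almost surely the ROOT shell is coarse-good; and the line contains 9229
  have hcoarse : ∀ᵐ μ ∂P, GoodShell 20 μ :=
    ae_coarseGood_of_coarsePricing hC hδ P hP hcore hstat hEn
  have hU : UnimodularEnergyLowerBound := unimodularEnergyLowerBound_of_coarsePricing hC
  -- Palm transfer: almost surely EVERY point is coarse-good
  have hevery : ∀ᵐ μ ∂P, ∀ y : E3, μ {y} ≠ 0 → GoodShell 20 (Measure.map (fun z => z - y) μ) := by
    have h := hE δ hδ P hcore hstat {μ | GoodShell 20 μ} hcoarse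
    simpa only [Set.mem_setOf_eq] using h
  -- zero holonomy: almost surely the configuration is Barlow-charted
  have hchart : ∀ᵐ μ ∂P, ∃ S : Set E3,
      μ = (Measure.count : Measure E3).restrict S ∧ IsBarlowCharted S := by
    filter_upwards [hcore, hevery] with μ hμ hgood
    obtain ⟨S, h0, -, rfl⟩ := hμ
    refine ⟨S, rfl, hCh S ⟨0, h0⟩ fun x hx => ?_⟩
    have h := hgood x ((count_restrict_singleton_ne_zero_iff S x).2 hx)
    rwa [map_sub_count_restrict] at h
  -- rung 2: tube Liouville
  exact hR δ hδ P hP hcore hstat hEn hU hevery hchart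

/-- **`MinimiserShells_of`** — the skeleton theorem: the crux
`Summit.AtomisticToContinuum.Crystallization.Theses.PalmUnimodularRigidity.MinimiserShells` BY NAME
from the four registered stubs `stub_coarsePricing`, `stub_everyPoint`, `stub_chart`,
`stub_tubeLiouville` (the only declarations of this file containing `sorry`) through the
sorry-free `minimiserShells_of_rungs` and the definitional `minimiserShells_iff`. -/
theorem MinimiserShells_of : MinimiserShells :=
  minimiserShells_iff.2
    (minimiserShells_of_rungs stub_coarsePricing stub_everyPoint stub_chart stub_tubeLiouville)

end Summit.AtomisticToContinuum.Crystallization.Cruxes.MinimiserShells.CoarseHolonomyLiouville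

end
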